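import Summits.CriticalPhenomena.CardyFormulaZ2.Theses.CardyQContinuation
import Summits.CriticalPhenomena.SAWScalingLimit.Theorems.SAWLoopFugacityFlowIsingBoundaryRatioWindowRectSucc
import Literature.Probability.LatticeModels.DiscreteRectBoundaryTrace

/-!
# Boundary tracing of a discrete domain is injective and periodic on external darts
(route CardyQContinuation, serves stmt-CriticalPhenomena-5560, registered stub
`stub_loopSymmetricLimit_succPeriodic` of the n = 0 bridge of the crux `IsingJetsConformal`)

The n = 0 bridge of the crux applies the Chelkak–Smirnov crossing theorem to designed polyomino
quadrilaterals, which must be presented as `DiscreteRect.IsRect E d₀ n`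
(`FKIsingTopologicalRectangleCrossing.lean`): one boundary-tracing orbit of `DiscreteRect.succ E`
through all external darts. The first brick of that presentation is purely combinatorial and holds
for EVERY finite edge set `E ⊆ Sym2 (ℤ²)`:

* `DiscreteRect.succ E` is injective on the external darts
  `IsExtDart E d := d.1 ∈ verts E ∧ s(d.1, d.1 + dir d.2) ∉ E` (the successor has a two-sided inverse
  there, the clockwise mirror of its definition);
* since `succ E` maps external darts to external darts (`DiscreteRect.IsExtDart.succ`) and these are
  finitely many, every orbit is periodic with a least period `N > 0`, within which the darts are
  pairwise distinct (pigeonhole).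

Both facts are already in the tree, proved for the boundary-ratio crux of the sibling problem
`SAWScalingLimit` (`Summit.CriticalPhenomena.SAWScalingLimit.Theorems.IsingBoundaryRatio.WindowRect.succ_injOn`,
`….discreteRect_exists_period`, file `SAWLoopFugacityFlowIsingBoundaryRatioWindowRectSucc.lean`,
which only imports `Literature` bookkeeping of `DiscreteRect.succ`); this file re-exports them in the
registered shape of the stub. No new mathematics. [folklore]

References: D. Chelkak, H. Duminil-Copin, C. Hongler, EJP 21 (2016) no. 5, §2.1 ("natural cyclic
order on `∂Ω`").
-/

namespace Summit.CriticalPhenomena.CardyFormulaZ2.Theorems.CardyQContinuation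

open Literature.Probability.LatticeModels

namespace SuccPeriodic

open Summit.CriticalPhenomena.SAWScalingLimit.Theorems.IsingBoundaryRatio

/-- `DiscreteRect.succ E` is injective on the external darts of any finite edge set `E`
(re-export of `WindowRect.succ_injOn`). [folklore] -/
theorem succ_injOn (E : Finset (Sym2 (Site 2))) :
    Set.InjOn (DiscreteRect.succ E) {d | DiscreteRect.IsExtDart E d} :=
  WindowRect.succ_injOn E

/-- The boundary-tracing orbit of an external dart is periodic with a period `N > 0` within which
its darts are pairwise distinct (re-export of `discreteRect_exists_period`). [folklore] -/
theorem exists_period {E : Finset (Sym2 (Site 2))} {d : Site 2 × Fin 4}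
    (hd : DiscreteRect.IsExtDart E d) :
    ∃ N : ℕ, 0 < N ∧ (DiscreteRect.succ E)^[N] d = d ∧
      ∀ i j : ℕ, i < N → j < N → (DiscreteRect.succ E)^[i] d = (DiscreteRect.succ E)^[j] d → i = j :=
  discreteRect_exists_period hd

end SuccPeriodic

open SuccPeriodic in
/-- **Registered stub `stub_loopSymmetricLimit_succPeriodic`** of the n = 0 bridge of the crux
`IsingJetsConformal` (stmt-CriticalPhenomena-5560): for every finite edge set `E` of `ℤ²`,
(1) boundary tracing `DiscreteRect.succ E` is injective on the external darts, and (2) the orbit of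
every external dart is periodic with some period `N > 0` and injective on `[0, N)`. [folklore] -/
theorem stub_loopSymmetricLimit_succPeriodic : ((∀ (E : Finset (Sym2 (Literature.Probability.LatticeModels.Site 2))), Set.InjOn (Literature.Probability.LatticeModels.DiscreteRect.succ E) {d | Literature.Probability.LatticeModels.DiscreteRect.IsExtDart E d}) ∧ (∀ (E : Finset (Sym2 (Literature.Probability.LatticeModels.Site 2))) (d : Literature.Probability.LatticeModels.Site 2 × Fin 4), Literature.Probability.LatticeModels.DiscreteRect.IsExtDart E d → ∃ N : ℕ, 0 < N ∧ (Literature.Probability.LatticeModels.DiscreteRect.succ E)^[N] d = d ∧ ∀ i j : ℕ, i < N → j < N → (Literature.Probability.LatticeModels.DiscreteRect.succ E)^[i] d = (Literature.Probability.LatticeModels.DiscreteRect.succ E)^[j] d → i = j)) := by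
  exact ⟨succ_injOn, fun E d hd => exists_period hd⟩

end Summit.CriticalPhenomena.CardyFormulaZ2.Theorems.CardyQContinuation
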